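import Summits.QuantumFields.YangMills.Theorems.UnitScaleTiltProp7N32SymSparseRow
import Summits.QuantumFields.YangMills.Theorems.UnitScaleTiltProp7TrueLinIterLocalL2
import Summits.QuantumFields.YangMills.Theorems.UnitScaleTiltProp7TrueLinSparseSupport
import Summits.QuantumFields.YangMills.Theorems.UnitScaleTiltProp7N32SymLevelRowReals
import HarnessLib

/-!
# Route `UnitScaleTilt`, crux K1 «MinimiserStabilityRegPr» (stmt-QuantumFields-19200), route-R (β) R0 REM2ˢ, row «(n3)₂-sym» = H2-1ˢ, file N6b —
# THE SECOND-ORDER REMAINDER IN `ℓ¹` FROM LOCALISED LEVEL-0 MASSES: ✓N6a on the centre chains and support families OF RECORD (w5 g8's N2′), the localised first-order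
# masses taken down to level 0 by the local `ℓ²` contraction of the sourceless reduced family (w5 g8's N3) plus `2^d` times the GLOBAL deviation `Σ‖Y_i − G¹_i‖²`

Cell `ym3-torus` (HUMAN RULING D-0037: YM₃ on the three-torus is ladder rung R3 — not d = 4, not infinite volume, not a mass gap, not Clay), width seat `ym3-torus-px21` (gen 7),
pen of the «(n3)₂-sym» supplier (px13 g6 «GO» 2026-08-29 07:50Z).  THEOREMS ONLY (0 `def`, 0 `sorry`); `--supports stmt-QuantumFields-19200 --as helper`, count-neutral.
Nothing here claims the «(n3)₂-sym» row, (β), the stub, the crux, d = 4 or the mass gap.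

THE POINT.  ✓p709520 `Prop7N32SymSparseRow.sum_norm_levelRatio_sub_trueLinIter_le_sparse` leaves on the right, per level `j < k` and per centre `z`, the localised masses
`Σ_{b∈C^{z}_i}‖Y_i(b)‖²`.  With the centre chains `S^k_i = {w : (w κ).val % L^{k−i} = (L^{k−i}−1)∕2}` (✓`Prop7TorusCentreChains`: `centres_top`, `emb_mem_centres`) and the support
families `C^{j,z}_i = {b : |b₋ − centre|_∞ ≤ L^{j+1−i} − 2}` (✓`Prop7TrueLinSparseSupport`: `mem_family_top`, `mem_family_of_mem_succ`, `sum_sum_family_le`) OF RECORD, and the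
first-order structure `Y_i = G¹_i + (Y_i − G¹_i)` with `G¹` the SOURCELESS reduced family of the true-linearised iterate of `Y_0 = pertVar U₀ W` (✓`Prop7TrueLinIterStructure` ∕
✓`exists_reduced_family`): `Σ_{b∈C^{j,z}_i}‖Y_i‖² ≤ 2·Σ_{C^{j,z}_i}‖G¹_i‖² + 2·Σ_{C^{j,z}_i}‖Y_i − G¹_i‖²`, the first `≤ 2·ρ₂ⁱ·E′ᵢ·Σ_{b∈C^{j,z}_0}‖Y_0 b‖²` by w5 g8's
✓`Prop7TrueLinIterLocalL2.sum_normSq_reduced_le_local` on the nested family, the second summed over ALL centres `≤ 2^d·Σ_b‖Y_i b − G¹_i b‖²` by `sum_sum_family_le`.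
What stays displayed: the GLOBAL level masses `Σ‖Y_i‖²` ((n3)), the global deviations `Σ‖Y_i − G¹_i‖²` (= `‖D_i + PΛ¹_i‖²`: ✓`FibreLevelMass` + ✓`CovIterLambdaHLambda` at the member),
and the LEVEL-0 localised masses `Σ_{z∈S^k_{j+1}}Σ_{b∈C^{j,z}_0}(‖Y_0 b − X b‖, ‖Y_0 b‖²)` (N4 + N4b at the member).

WHAT IS PROVED (ns `…Theorems.Prop7N32SymLocalisedRow`; `SU(N)`, any `P`, `k ≤ m + K`).
* `sum_mul_localised_le` — the real bookkeeping of one level `j` (exchange of the centre sum with the inner level sum).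
* ★★★ `sum_norm_levelRatio_sub_trueLinIter_le_localised` — the title.
* ★★ `sum_norm_levelRatio_sub_trueLinIter_le_of_rows` — §2 in the two-slot form `A·(Lᵏ)⁻¹ + B·Lᵏ` modulo the displayed rows (✓`Prop7N32SymLevelRowReals.real_assembly`).
HONEST SCOPE.  Bookkeeping over landed bricks (✓p709520, w5 g8's ✓N3∕N2′); nothing of [Balaban1985Averaging] ∕ [Balaban1984PropagatorsI] is asserted beyond the cited tree theorems;
no localisation inequality, no member numerals here.
References: T. Bałaban, CMP 98 (1985) 17–51 [Balaban1985Averaging] (Prop. 3 (122)–(126) p.36); CMP 95 (1984) 17–40 [Balaban1984PropagatorsI] ((1.18)–(1.20) pp.19–20);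
CMP 102 (1985) 277–309 [Balaban1985Variational] ((15) p.280, Prop. 7 p.299); CMP 109 (1987) 249–301 [Balaban1987RG1] ((0.3)–(0.4) pp.252–253).
-/

set_option autoImplicit false

noncomputable section

open scoped BigOperators Matrix.Norms.L2Operator

namespace Summit.QuantumFields.YangMills.Theorems.Prop7N32SymLocalisedRow

open Literature.MathematicalPhysics.QuantumFieldTheory.Balaban1983to89
open Finset T4Continuum BlockAveraging AveragingRT ExpMeanLog BlockAveragingEMLLinearised BlockAveragingEMLLinearisedBackground BlockAveragingEMLProp2
open Summit.QuantumFields.YangMills.Theorems.Prop7N32SymSparseRow (sum_norm_levelRatio_sub_trueLinIter_le_sparse)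
open Summit.QuantumFields.YangMills.Theorems.Prop7TrueLinIterLocalL2 (sum_normSq_reduced_le_local)
open Summit.QuantumFields.YangMills.Theorems.Prop7TorusCentreChains (centres_top emb_mem_centres)
open Summit.QuantumFields.YangMills.Theorems.Prop7TrueLinSparseSupport (mem_family_top mem_family_of_mem_succ sum_sum_family_le)
open Summit.QuantumFields.YangMills.Theorems.Prop7N32SymLevelRowReals (real_assembly)

variable {P : Params} {N : ℕ} [NeZero N]

/-! ## §1 Real bookkeeping of one level -/

omit [NeZero N] in
/-- Exchange of the centre sum with the inner level sum, with the deviation summed out. [folklore] -/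
theorem sum_mul_localised_le {ι : Type*} (S : Finset ι) (T : Finset ℕ) {E r c : ℝ} (hE : 0 ≤ E) (hc : 0 ≤ c)
    (A B : ι → ℝ) (w α : ℕ → ℝ) (hw : ∀ i ∈ T, 0 ≤ w i) (D : ι → ℕ → ℝ) (Dt : ℕ → ℝ) (hD : ∀ i ∈ T, ∑ z ∈ S, D z i ≤ Dt i) :
    ∑ z ∈ S, E * (r * A z + ∑ i ∈ T, w i * (c * (2 * (α i * B z) + 2 * D z i)))
      ≤ E * (r * ∑ z ∈ S, A z + ∑ i ∈ T, w i * (c * (2 * (α i * ∑ z ∈ S, B z) + 2 * Dt i))) := by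
  rw [← Finset.mul_sum]
  refine mul_le_mul_of_nonneg_left ?_ hE
  rw [Finset.sum_add_distrib, ← Finset.mul_sum, Finset.sum_comm]
  refine add_le_add le_rfl (Finset.sum_le_sum fun i hi => ?_)
  rw [← Finset.mul_sum, ← Finset.mul_sum]
  refine mul_le_mul_of_nonneg_left (mul_le_mul_of_nonneg_left ?_ hc) (hw i hi)
  rw [Finset.sum_add_distrib, ← Finset.mul_sum, ← Finset.mul_sum, ← Finset.mul_sum]
  linarith [hD i hi]

/-! ## §2 ★★★ The localised row -/

/-- ★★★ **THE SECOND-ORDER REMAINDER OF THE LEVEL RATIOS IN `ℓ¹` FROM LOCALISED LEVEL-0 MASSES.**  `U₀, W ∈ SU(N)`, `k ≤ m + K`; `Q` the true-linearised iterate along the tower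
of `U₀`; `G¹` its SOURCELESS reduced family started at `Y_0 = pertVar U₀ W` (`hG10`, `hG1s`); `X` any initial field; loop sizes `a_j` and E10 sup sizes `s_j` as in ✓N6a.  With the
centre chains `S^k_i` and support families `C^{j,z}_i` OF RECORD (written inline), `ρ₁ = (L^d)⁻¹L`, `ρ₂ = (L^d)⁻¹L²`, `E_j = exp((κ₁∕ρ₁)Σ_{i<j}a_i)`, `E′_i = exp(2(κ₂∕√ρ₂)Σ_{j<i}a_j)`,
`c_E = 260((d+2)L)²(2dL^d)(2d)`:
`Σ_c‖Y_k c − Q k X c‖ ≤ E_k·(ρ₁ᵏ·Σ_b‖Y_0 b − X b‖ + Σ_{i<k}ρ₁^{k−1−i}·c_E·Σ_b‖Y_i b‖²)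
  + 2d·Σ_{j<k}(d+2)L·E_j·(ρ₁ʲ·Σ_{z∈S^k_{j+1}}Σ_{b∈C^{j,z}_0}‖Y_0 b − X b‖ + Σ_{i<j}ρ₁^{j−1−i}·c_E·(2·ρ₂ⁱE′_i·Σ_{z∈S^k_{j+1}}Σ_{b∈C^{j,z}_0}‖Y_0 b‖² + 2·2^d·Σ_b‖Y_i b − G¹_i b‖²))`.
[cite: Balaban1985Averaging, Prop. 3 (122)-(126) p.36; Balaban1984PropagatorsI, (1.18)-(1.20) pp.19-20; Balaban1985Variational, (15) p.280, Prop. 7 p.299] -/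
theorem sum_norm_levelRatio_sub_trueLinIter_le_localised (U₀ W : GaugeField P 0 (Matrix.specialUnitaryGroup (Fin N) ℂ)) {k : ℕ} (hk : k ≤ P.m + P.K)
    (Q : (k : ℕ) → (PBond P 0 → Matrix (Fin N) (Fin N) ℂ) → PBond P k → Matrix (Fin N) (Fin N) ℂ) (hQ0 : ∀ Y, Q 0 Y = Y)
    (hQs : ∀ (k : ℕ) (Y : PBond P 0 → Matrix (Fin N) (Fin N) ℂ) (c : PBond P (k + 1)), Q (k + 1) Y c
      = (fderiv ℂ (eml : (Idx P → Matrix (Fin N) (Fin N) ℂ) → Matrix (Fin N) (Fin N) ℂ)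
            (fun i => ((loopHol (Averaging.iter (fun i => blockAvg (P := P) (j := i) (expMeanLogSU (n := Fin N))) k U₀) c i : Matrix.specialUnitaryGroup (Fin N) ℂ) : Matrix (Fin N) (Fin N) ℂ))
            (fun i => covWalkSum (Averaging.iter (fun i => blockAvg (P := P) (j := i) (expMeanLogSU (n := Fin N))) k U₀) (Q k Y) (walk (emb c.src) (loopWord P.L c.dir (off i.1) i.2.1 i.2.2))
              * ((loopHol (Averaging.iter (fun i => blockAvg (P := P) (j := i) (expMeanLogSU (n := Fin N))) k U₀) c i : Matrix.specialUnitaryGroup (Fin N) ℂ) : Matrix (Fin N) (Fin N) ℂ))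
            * star ((corr (expMeanLogSU (n := Fin N)) (Averaging.iter (fun i => blockAvg (P := P) (j := i) (expMeanLogSU (n := Fin N))) k U₀) c : Matrix.specialUnitaryGroup (Fin N) ℂ) : Matrix (Fin N) (Fin N) ℂ)
          + ((corr (expMeanLogSU (n := Fin N)) (Averaging.iter (fun i => blockAvg (P := P) (j := i) (expMeanLogSU (n := Fin N))) k U₀) c : Matrix.specialUnitaryGroup (Fin N) ℂ) : Matrix (Fin N) (Fin N) ℂ)
            * covWalkSum (Averaging.iter (fun i => blockAvg (P := P) (j := i) (expMeanLogSU (n := Fin N))) k U₀) (Q k Y) (walk (emb c.src) (List.replicate P.L (c.dir, true)))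
            * star ((corr (expMeanLogSU (n := Fin N)) (Averaging.iter (fun i => blockAvg (P := P) (j := i) (expMeanLogSU (n := Fin N))) k U₀) c : Matrix.specialUnitaryGroup (Fin N) ℂ) : Matrix (Fin N) (Fin N) ℂ)))
    (G1 : (k : ℕ) → PBond P k → Matrix (Fin N) (Fin N) ℂ) (hG10 : ∀ b, G1 0 b = pertVar U₀ W b)
    (hG1s : ∀ (k : ℕ) (c : PBond P (k + 1)), G1 (k + 1) c
      = (fderiv ℂ (eml : (Idx P → Matrix (Fin N) (Fin N) ℂ) → Matrix (Fin N) (Fin N) ℂ)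
            (fun i => ((loopHol (Averaging.iter (fun i => blockAvg (P := P) (j := i) (expMeanLogSU (n := Fin N))) k U₀) c i : Matrix.specialUnitaryGroup (Fin N) ℂ) : Matrix (Fin N) (Fin N) ℂ))
            (fun i => covWalkSum (Averaging.iter (fun i => blockAvg (P := P) (j := i) (expMeanLogSU (n := Fin N))) k U₀) (G1 k) (walk (emb c.src) (loopWord P.L c.dir (off i.1) i.2.1 i.2.2))
              * ((loopHol (Averaging.iter (fun i => blockAvg (P := P) (j := i) (expMeanLogSU (n := Fin N))) k U₀) c i : Matrix.specialUnitaryGroup (Fin N) ℂ) : Matrix (Fin N) (Fin N) ℂ))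
            * star ((corr (expMeanLogSU (n := Fin N)) (Averaging.iter (fun i => blockAvg (P := P) (j := i) (expMeanLogSU (n := Fin N))) k U₀) c : Matrix.specialUnitaryGroup (Fin N) ℂ) : Matrix (Fin N) (Fin N) ℂ)
          + ((corr (expMeanLogSU (n := Fin N)) (Averaging.iter (fun i => blockAvg (P := P) (j := i) (expMeanLogSU (n := Fin N))) k U₀) c : Matrix.specialUnitaryGroup (Fin N) ℂ) : Matrix (Fin N) (Fin N) ℂ)
            * covWalkSum (Averaging.iter (fun i => blockAvg (P := P) (j := i) (expMeanLogSU (n := Fin N))) k U₀) (G1 k) (walk (emb c.src) (List.replicate P.L (c.dir, true)))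
            * star ((corr (expMeanLogSU (n := Fin N)) (Averaging.iter (fun i => blockAvg (P := P) (j := i) (expMeanLogSU (n := Fin N))) k U₀) c : Matrix.specialUnitaryGroup (Fin N) ℂ) : Matrix (Fin N) (Fin N) ℂ))
        - ((((Fintype.card (Idx P) : ℂ))⁻¹ • ∑ i : Idx P,
              covWalkSum (Averaging.iter (fun i => blockAvg (P := P) (j := i) (expMeanLogSU (n := Fin N))) k U₀) (G1 k) (walk (emb c.src) (stairWord i.2.1 (off i.1))))
            - (((Averaging.iter (fun i => blockAvg (P := P) (j := i) (expMeanLogSU (n := Fin N))) (k + 1) U₀) c : Matrix.specialUnitaryGroup (Fin N) ℂ) : Matrix (Fin N) (Fin N) ℂ)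
              * (((Fintype.card (Idx P) : ℂ))⁻¹ • ∑ i : Idx P,
              covWalkSum (Averaging.iter (fun i => blockAvg (P := P) (j := i) (expMeanLogSU (n := Fin N))) k U₀) (G1 k) (walk (emb c.tgt) (stairWord i.2.1 (off i.1))))
              * star (((Averaging.iter (fun i => blockAvg (P := P) (j := i) (expMeanLogSU (n := Fin N))) (k + 1) U₀) c : Matrix.specialUnitaryGroup (Fin N) ℂ) : Matrix (Fin N) (Fin N) ℂ)))
    (X : PBond P 0 → Matrix (Fin N) (Fin N) ℂ)
    (a : ℕ → ℝ) (ha0 : ∀ j, 0 ≤ a j)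
    (hα : ∀ j < k, ∀ (c : PBond P (j + 1)) (i : Idx P), dist1 (loopHol (Averaging.iter (fun i => blockAvg (P := P) (j := i) (expMeanLogSU (n := Fin N))) j U₀) c i) ≤ a j)
    (ha24 : ∀ j < k, a j ≤ 1 / 24) (haN : ∀ j < k, a j < deltaSU (Fin N))
    (s : ℕ → ℝ) (hs0 : ∀ j < k, 0 ≤ s j)
    (hs : ∀ j < k, ∀ b : PBond P j, ‖(pertVar (Averaging.iter (fun i => blockAvg (P := P) (j := i) (expMeanLogSU (n := Fin N))) j U₀) (Averaging.iter (fun i => blockAvg (P := P) (j := i) (expMeanLogSU (n := Fin N))) j W)) b‖ ≤ s j)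
    (h72 : ∀ j < k, 72 * ((((P.d + 2) * P.L : ℕ) : ℝ) * ((2 * P.d * (P.L : ℝ) ^ P.d) * s j)) ≤ 1)
    (hsN : ∀ j < k, 3 * ((((P.d + 2) * P.L : ℕ) : ℝ) * ((2 * P.d * (P.L : ℝ) ^ P.d) * s j)) + a j < deltaSU (Fin N)) :
    ∑ c : PBond P k, ‖(pertVar (Averaging.iter (fun i => blockAvg (P := P) (j := i) (expMeanLogSU (n := Fin N))) k U₀) (Averaging.iter (fun i => blockAvg (P := P) (j := i) (expMeanLogSU (n := Fin N))) k W)) c - Q k X c‖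
      ≤ Real.exp ((159 * (((P.d + 2) * P.L : ℕ) : ℝ) * (2 * P.d)) / (((P.L : ℝ) ^ P.d)⁻¹ * (P.L : ℝ)) * ∑ i ∈ Finset.range k, a i)
          * ((((P.L : ℝ) ^ P.d)⁻¹ * (P.L : ℝ)) ^ k * (∑ b : PBond P 0, ‖pertVar U₀ W b - X b‖)
            + ∑ i ∈ Finset.range k, (((P.L : ℝ) ^ P.d)⁻¹ * (P.L : ℝ)) ^ (k - 1 - i) * ((260 * ((((P.d + 2) * P.L : ℕ) : ℝ)) ^ 2 * (2 * P.d * (P.L : ℝ) ^ P.d) * (2 * P.d)) * ∑ b : PBond P i, ‖(pertVar (Averaging.iter (fun i => blockAvg (P := P) (j := i) (expMeanLogSU (n := Fin N))) i U₀) (Averaging.iter (fun i => blockAvg (P := P) (j := i) (expMeanLogSU (n := Fin N))) i W)) b‖ ^ 2))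
        + 2 * P.d * ∑ j ∈ Finset.range k, (((P.d + 2) * P.L : ℕ) : ℝ) * (Real.exp ((159 * (((P.d + 2) * P.L : ℕ) : ℝ) * (2 * P.d)) / (((P.L : ℝ) ^ P.d)⁻¹ * (P.L : ℝ)) * ∑ i ∈ Finset.range j, a i)
              * ((((P.L : ℝ) ^ P.d)⁻¹ * (P.L : ℝ)) ^ j * (∑ z ∈ (univ.filter (fun w : Site P (j + 1) => ∀ κ, (w κ).val % P.L ^ (k - (j + 1)) = (P.L ^ (k - (j + 1)) - 1) / 2)), ∑ b ∈ (univ.filter (fun b : PBond P 0 => ∀ κ, ((b.src κ - (((z κ).val * P.L ^ (j + 1 - 0) + (P.L ^ (j + 1 - 0) - 1) / 2 : ℕ) : ZMod (P.sitesPerDir 0))).valMinAbs).natAbs ≤ P.L ^ (j + 1 - 0) - 2)), ‖pertVar U₀ W b - X b‖)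
                + ∑ i ∈ Finset.range j, (((P.L : ℝ) ^ P.d)⁻¹ * (P.L : ℝ)) ^ (j - 1 - i) * ((260 * ((((P.d + 2) * P.L : ℕ) : ℝ)) ^ 2 * (2 * P.d * (P.L : ℝ) ^ P.d) * (2 * P.d)) *
                    (2 * ((((P.L : ℝ) ^ P.d)⁻¹ * (P.L : ℝ) ^ 2) ^ i * Real.exp (2 * ((159 * (((P.d + 2) * P.L : ℕ) : ℝ) * Real.sqrt (2 * P.d * (P.L : ℝ) ^ P.d * (2 * P.d))) / Real.sqrt (((P.L : ℝ) ^ P.d)⁻¹ * (P.L : ℝ) ^ 2) * ∑ j ∈ Finset.range i, a j))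
                          * ∑ z ∈ (univ.filter (fun w : Site P (j + 1) => ∀ κ, (w κ).val % P.L ^ (k - (j + 1)) = (P.L ^ (k - (j + 1)) - 1) / 2)), ∑ b ∈ (univ.filter (fun b : PBond P 0 => ∀ κ, ((b.src κ - (((z κ).val * P.L ^ (j + 1 - 0) + (P.L ^ (j + 1 - 0) - 1) / 2 : ℕ) : ZMod (P.sitesPerDir 0))).valMinAbs).natAbs ≤ P.L ^ (j + 1 - 0) - 2)), ‖pertVar U₀ W b‖ ^ 2)
                      + 2 * (2 ^ P.d * ∑ b : PBond P i, ‖(pertVar (Averaging.iter (fun i => blockAvg (P := P) (j := i) (expMeanLogSU (n := Fin N))) i U₀) (Averaging.iter (fun i => blockAvg (P := P) (j := i) (expMeanLogSU (n := Fin N))) i W)) b - G1 i b‖ ^ 2))))) := by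
  have hLpos : (0 : ℝ) < (P.L : ℝ) := by exact_mod_cast P.L_pos
  have hρ0 : (0 : ℝ) ≤ (((P.L : ℝ) ^ P.d)⁻¹ * (P.L : ℝ)) := by positivity
  have hcE0 : (0 : ℝ) ≤ (260 * ((((P.d + 2) * P.L : ℕ) : ℝ)) ^ 2 * (2 * P.d * (P.L : ℝ) ^ P.d) * (2 * P.d)) := by positivity
  have hE0 : ∀ j, 0 ≤ Real.exp ((159 * (((P.d + 2) * P.L : ℕ) : ℝ) * (2 * P.d)) / (((P.L : ℝ) ^ P.d)⁻¹ * (P.L : ℝ)) * ∑ i ∈ Finset.range j, a i) := fun j => (Real.exp_pos _).le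
  have hC0 : (0 : ℝ) ≤ (((P.d + 2) * P.L : ℕ) : ℝ) := Nat.cast_nonneg _
  -- ★★★ N6a with the centre chains `S^k` and the support families `C^{j,z}` of record
  have hmain := sum_norm_levelRatio_sub_trueLinIter_le_sparse U₀ W hk Q hQ0 hQs X a ha0 hα ha24 haN s hs0 hs h72 hsN
    (fun i => (univ.filter (fun w : Site P i => ∀ κ, (w κ).val % P.L ^ (k - i) = (P.L ^ (k - i) - 1) / 2)))
    (fun i hi z hz => emb_mem_centres (P := P) (l := k) (i := i) (Nat.succ_le_of_lt hi) (by omega) z hz)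
    (centres_top (P := P) k)
    (fun j z i => (univ.filter (fun b : PBond P i => ∀ κ, ((b.src κ - (((z κ).val * P.L ^ (j + 1 - i) + (P.L ^ (j + 1 - i) - 1) / 2 : ℕ) : ZMod (P.sitesPerDir i))).valMinAbs).natAbs ≤ P.L ^ (j + 1 - i) - 2)))
    (fun j hj z _ b hb => mem_family_top (P := P) (by omega) z b hb)
    (fun j hj z _ i hi c hc b hb => mem_family_of_mem_succ (P := P) (by omega) (Nat.succ_le_of_lt hi) z c hc b hb)
  refine hmain.trans (add_le_add le_rfl ?_)
  refine mul_le_mul_of_nonneg_left (Finset.sum_le_sum fun j hj => ?_) (by positivity)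
  have hjk : j < k := Finset.mem_range.mp hj
  refine mul_le_mul_of_nonneg_left ?_ hC0
  -- per centre: `‖Y_i‖² ≤ 2‖G¹_i‖² + 2‖Y_i − G¹_i‖²` on the family, and N3 on the reduced part
  have hsplit : ∀ z ∈ (univ.filter (fun w : Site P (j + 1) => ∀ κ, (w κ).val % P.L ^ (k - (j + 1)) = (P.L ^ (k - (j + 1)) - 1) / 2)),
      Real.exp ((159 * (((P.d + 2) * P.L : ℕ) : ℝ) * (2 * P.d)) / (((P.L : ℝ) ^ P.d)⁻¹ * (P.L : ℝ)) * ∑ i ∈ Finset.range j, a i)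
        * ((((P.L : ℝ) ^ P.d)⁻¹ * (P.L : ℝ)) ^ j * (∑ b ∈ (univ.filter (fun b : PBond P 0 => ∀ κ, ((b.src κ - (((z κ).val * P.L ^ (j + 1 - 0) + (P.L ^ (j + 1 - 0) - 1) / 2 : ℕ) : ZMod (P.sitesPerDir 0))).valMinAbs).natAbs ≤ P.L ^ (j + 1 - 0) - 2)), ‖pertVar U₀ W b - X b‖)
          + ∑ i ∈ Finset.range j, (((P.L : ℝ) ^ P.d)⁻¹ * (P.L : ℝ)) ^ (j - 1 - i) * ((260 * ((((P.d + 2) * P.L : ℕ) : ℝ)) ^ 2 * (2 * P.d * (P.L : ℝ) ^ P.d) * (2 * P.d)) * ∑ b ∈ (univ.filter (fun b : PBond P i => ∀ κ, ((b.src κ - (((z κ).val * P.L ^ (j + 1 - i) + (P.L ^ (j + 1 - i) - 1) / 2 : ℕ) : ZMod (P.sitesPerDir i))).valMinAbs).natAbs ≤ P.L ^ (j + 1 - i) - 2)), ‖(pertVar (Averaging.iter (fun i => blockAvg (P := P) (j := i) (expMeanLogSU (n := Fin N))) i U₀) (Averaging.iter (fun i => blockAvg (P := P) (j := i) (expMeanLogSU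 (n := Fin N))) i W)) b‖ ^ 2))
      ≤ Real.exp ((159 * (((P.d + 2) * P.L : ℕ) : ℝ) * (2 * P.d)) / (((P.L : ℝ) ^ P.d)⁻¹ * (P.L : ℝ)) * ∑ i ∈ Finset.range j, a i)
        * ((((P.L : ℝ) ^ P.d)⁻¹ * (P.L : ℝ)) ^ j * (∑ b ∈ (univ.filter (fun b : PBond P 0 => ∀ κ, ((b.src κ - (((z κ).val * P.L ^ (j + 1 - 0) + (P.L ^ (j + 1 - 0) - 1) / 2 : ℕ) : ZMod (P.sitesPerDir 0))).valMinAbs).natAbs ≤ P.L ^ (j + 1 - 0) - 2)), ‖pertVar U₀ W b - X b‖)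
          + ∑ i ∈ Finset.range j, (((P.L : ℝ) ^ P.d)⁻¹ * (P.L : ℝ)) ^ (j - 1 - i) * ((260 * ((((P.d + 2) * P.L : ℕ) : ℝ)) ^ 2 * (2 * P.d * (P.L : ℝ) ^ P.d) * (2 * P.d)) *
              (2 * (((((P.L : ℝ) ^ P.d)⁻¹ * (P.L : ℝ) ^ 2) ^ i * Real.exp (2 * ((159 * (((P.d + 2) * P.L : ℕ) : ℝ) * Real.sqrt (2 * P.d * (P.L : ℝ) ^ P.d * (2 * P.d))) / Real.sqrt (((P.L : ℝ) ^ P.d)⁻¹ * (P.L : ℝ) ^ 2) * ∑ j ∈ Finset.range i, a j))) * ∑ b ∈ (univ.filter (fun b : PBond P 0 => ∀ κ, ((b.src κ - (((z κ).val * P.L ^ (j + 1 - 0) + (P.L ^ (j + 1 - 0) - 1) / 2 : ℕ) : ZMod (P.sitesPerDir 0))).valMinAbs).natAbs ≤ P.L ^ (j + 1 - 0) - 2)), ‖pertVar U₀ W b‖ ^ 2)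
                + 2 * ∑ b ∈ (univ.filter (fun b : PBond P i => ∀ κ, ((b.src κ - (((z κ).val * P.L ^ (j + 1 - i) + (P.L ^ (j + 1 - i) - 1) / 2 : ℕ) : ZMod (P.sitesPerDir i))).valMinAbs).natAbs ≤ P.L ^ (j + 1 - i) - 2)), ‖(pertVar (Averaging.iter (fun i => blockAvg (P := P) (j := i) (expMeanLogSU (n := Fin N))) i U₀) (Averaging.iter (fun i => blockAvg (P := P) (j := i) (expMeanLogSU (n := Fin N))) i W)) b - G1 i b‖ ^ 2))) := by
    intro z hz
    refine mul_le_mul_of_nonneg_left (add_le_add le_rfl (Finset.sum_le_sum fun i hi => ?_)) (hE0 j)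
    have hij : i < j := Finset.mem_range.mp hi
    refine mul_le_mul_of_nonneg_left (mul_le_mul_of_nonneg_left ?_ hcE0) (pow_nonneg hρ0 _)
    have hpt : ∀ b : PBond P i, ‖(pertVar (Averaging.iter (fun i => blockAvg (P := P) (j := i) (expMeanLogSU (n := Fin N))) i U₀) (Averaging.iter (fun i => blockAvg (P := P) (j := i) (expMeanLogSU (n := Fin N))) i W)) b‖ ^ 2 ≤ 2 * ‖G1 i b‖ ^ 2 + 2 * ‖(pertVar (Averaging.iter (fun i => blockAvg (P := P) (j := i) (expMeanLogSU (n := Fin N))) i U₀) (Averaging.iter (fun i => blockAvg (P := P) (j := i) (expMeanLogSU (n := Fin N))) i W)) b - G1 i b‖ ^ 2 := by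
      intro b
      have h := norm_add_le (G1 i b) ((pertVar (Averaging.iter (fun i => blockAvg (P := P) (j := i) (expMeanLogSU (n := Fin N))) i U₀) (Averaging.iter (fun i => blockAvg (P := P) (j := i) (expMeanLogSU (n := Fin N))) i W)) b - G1 i b)
      rw [add_sub_cancel] at h
      refine (pow_le_pow_left₀ (norm_nonneg _) h 2).trans ?_
      nlinarith [sq_nonneg (‖G1 i b‖ - ‖(pertVar (Averaging.iter (fun i => blockAvg (P := P) (j := i) (expMeanLogSU (n := Fin N))) i U₀) (Averaging.iter (fun i => blockAvg (P := P) (j := i) (expMeanLogSU (n := Fin N))) i W)) b - G1 i b‖)]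
    have hG1loc := sum_normSq_reduced_le_local U₀ G1 hG1s a ha0 (show i ≤ P.m + P.K by omega)
      (fun i' => (univ.filter (fun b : PBond P i' => ∀ κ, ((b.src κ - (((z κ).val * P.L ^ (j + 1 - i') + (P.L ^ (j + 1 - i') - 1) / 2 : ℕ) : ZMod (P.sitesPerDir i'))).valMinAbs).natAbs ≤ P.L ^ (j + 1 - i') - 2)))
      (fun i' hi' c hc b hb => mem_family_of_mem_succ (P := P) (by omega) (by omega) z c hc b hb)
      (fun i' hi' c _ idx => hα i' (by omega) c idx) (fun i' hi' => ha24 i' (by omega)) (fun i' hi' => haN i' (by omega))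
    beta_reduce at hG1loc
    have hG10' : ∑ b ∈ (univ.filter (fun b : PBond P 0 => ∀ κ, ((b.src κ - (((z κ).val * P.L ^ (j + 1 - 0) + (P.L ^ (j + 1 - 0) - 1) / 2 : ℕ) : ZMod (P.sitesPerDir 0))).valMinAbs).natAbs ≤ P.L ^ (j + 1 - 0) - 2)), ‖G1 0 b‖ ^ 2 = ∑ b ∈ (univ.filter (fun b : PBond P 0 => ∀ κ, ((b.src κ - (((z κ).val * P.L ^ (j + 1 - 0) + (P.L ^ (j + 1 - 0) - 1) / 2 : ℕ) : ZMod (P.sitesPerDir 0))).valMinAbs).natAbs ≤ P.L ^ (j + 1 - 0) - 2)), ‖pertVar U₀ W b‖ ^ 2 :=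
      Finset.sum_congr rfl fun b _ => by rw [hG10]
    rw [hG10'] at hG1loc
    calc ∑ b ∈ (univ.filter (fun b : PBond P i => ∀ κ, ((b.src κ - (((z κ).val * P.L ^ (j + 1 - i) + (P.L ^ (j + 1 - i) - 1) / 2 : ℕ) : ZMod (P.sitesPerDir i))).valMinAbs).natAbs ≤ P.L ^ (j + 1 - i) - 2)), ‖(pertVar (Averaging.iter (fun i => blockAvg (P := P) (j := i) (expMeanLogSU (n := Fin N))) i U₀) (Averaging.iter (fun i => blockAvg (P := P) (j := i) (expMeanLogSU (n := Fin N))) i W)) b‖ ^ 2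
        ≤ ∑ b ∈ (univ.filter (fun b : PBond P i => ∀ κ, ((b.src κ - (((z κ).val * P.L ^ (j + 1 - i) + (P.L ^ (j + 1 - i) - 1) / 2 : ℕ) : ZMod (P.sitesPerDir i))).valMinAbs).natAbs ≤ P.L ^ (j + 1 - i) - 2)), (2 * ‖G1 i b‖ ^ 2 + 2 * ‖(pertVar (Averaging.iter (fun i => blockAvg (P := P) (j := i) (expMeanLogSU (n := Fin N))) i U₀) (Averaging.iter (fun i => blockAvg (P := P) (j := i) (expMeanLogSU (n := Fin N))) i W)) b - G1 i b‖ ^ 2) := Finset.sum_le_sum fun b _ => hpt b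
      _ = 2 * ∑ b ∈ (univ.filter (fun b : PBond P i => ∀ κ, ((b.src κ - (((z κ).val * P.L ^ (j + 1 - i) + (P.L ^ (j + 1 - i) - 1) / 2 : ℕ) : ZMod (P.sitesPerDir i))).valMinAbs).natAbs ≤ P.L ^ (j + 1 - i) - 2)), ‖G1 i b‖ ^ 2 + 2 * ∑ b ∈ (univ.filter (fun b : PBond P i => ∀ κ, ((b.src κ - (((z κ).val * P.L ^ (j + 1 - i) + (P.L ^ (j + 1 - i) - 1) / 2 : ℕ) : ZMod (P.sitesPerDir i))).valMinAbs).natAbs ≤ P.L ^ (j + 1 - i) - 2)), ‖(pertVar (Averaging.iter (fun i => blockAvg (P := P) (j := i) (expMeanLogSU (n := Fin N))) i U₀) (Averaging.iter (fun i => blockAvg (P := P) (j := i) (expMeanLogSU (n := Fin N))) i W)) b - G1 i b‖ ^ 2 := by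
          rw [Finset.sum_add_distrib, Finset.mul_sum, Finset.mul_sum]
      _ ≤ 2 * (((((P.L : ℝ) ^ P.d)⁻¹ * (P.L : ℝ) ^ 2) ^ i * Real.exp (2 * ((159 * (((P.d + 2) * P.L : ℕ) : ℝ) * Real.sqrt (2 * P.d * (P.L : ℝ) ^ P.d * (2 * P.d))) / Real.sqrt (((P.L : ℝ) ^ P.d)⁻¹ * (P.L : ℝ) ^ 2) * ∑ j ∈ Finset.range i, a j))) * ∑ b ∈ (univ.filter (fun b : PBond P 0 => ∀ κ, ((b.src κ - (((z κ).val * P.L ^ (j + 1 - 0) + (P.L ^ (j + 1 - 0) - 1) / 2 : ℕ) : ZMod (P.sitesPerDir 0))).valMinAbs).natAbs ≤ P.L ^ (j + 1 - 0) - 2)), ‖pertVar U₀ W b‖ ^ 2)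
          + 2 * ∑ b ∈ (univ.filter (fun b : PBond P i => ∀ κ, ((b.src κ - (((z κ).val * P.L ^ (j + 1 - i) + (P.L ^ (j + 1 - i) - 1) / 2 : ℕ) : ZMod (P.sitesPerDir i))).valMinAbs).natAbs ≤ P.L ^ (j + 1 - i) - 2)), ‖(pertVar (Averaging.iter (fun i => blockAvg (P := P) (j := i) (expMeanLogSU (n := Fin N))) i U₀) (Averaging.iter (fun i => blockAvg (P := P) (j := i) (expMeanLogSU (n := Fin N))) i W)) b - G1 i b‖ ^ 2 := by
          have h2 := mul_le_mul_of_nonneg_left hG1loc (show (0:ℝ) ≤ 2 by norm_num)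
          exact add_le_add h2 le_rfl
  refine (Finset.sum_le_sum hsplit).trans ?_
  -- exchange the centre sum with the level sum; the deviation summed over ALL centres is `≤ 2^d·Σ_b‖Y_i − G¹_i‖²` (N2′ (e))
  refine (sum_mul_localised_le (univ.filter (fun w : Site P (j + 1) => ∀ κ, (w κ).val % P.L ^ (k - (j + 1)) = (P.L ^ (k - (j + 1)) - 1) / 2)) (Finset.range j) (hE0 j) hcE0
    (fun z => ∑ b ∈ (univ.filter (fun b : PBond P 0 => ∀ κ, ((b.src κ - (((z κ).val * P.L ^ (j + 1 - 0) + (P.L ^ (j + 1 - 0) - 1) / 2 : ℕ) : ZMod (P.sitesPerDir 0))).valMinAbs).natAbs ≤ P.L ^ (j + 1 - 0) - 2)), ‖pertVar U₀ W b - X b‖)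
    (fun z => ∑ b ∈ (univ.filter (fun b : PBond P 0 => ∀ κ, ((b.src κ - (((z κ).val * P.L ^ (j + 1 - 0) + (P.L ^ (j + 1 - 0) - 1) / 2 : ℕ) : ZMod (P.sitesPerDir 0))).valMinAbs).natAbs ≤ P.L ^ (j + 1 - 0) - 2)), ‖pertVar U₀ W b‖ ^ 2)
    (fun i => (((P.L : ℝ) ^ P.d)⁻¹ * (P.L : ℝ)) ^ (j - 1 - i)) (fun i => (((P.L : ℝ) ^ P.d)⁻¹ * (P.L : ℝ) ^ 2) ^ i * Real.exp (2 * ((159 * (((P.d + 2) * P.L : ℕ) : ℝ) * Real.sqrt (2 * P.d * (P.L : ℝ) ^ P.d * (2 * P.d))) / Real.sqrt (((P.L : ℝ) ^ P.d)⁻¹ * (P.L : ℝ) ^ 2) * ∑ j ∈ Finset.range i, a j))) (fun i _ => pow_nonneg hρ0 _)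
    (fun z i => ∑ b ∈ (univ.filter (fun b : PBond P i => ∀ κ, ((b.src κ - (((z κ).val * P.L ^ (j + 1 - i) + (P.L ^ (j + 1 - i) - 1) / 2 : ℕ) : ZMod (P.sitesPerDir i))).valMinAbs).natAbs ≤ P.L ^ (j + 1 - i) - 2)), ‖(pertVar (Averaging.iter (fun i => blockAvg (P := P) (j := i) (expMeanLogSU (n := Fin N))) i U₀) (Averaging.iter (fun i => blockAvg (P := P) (j := i) (expMeanLogSU (n := Fin N))) i W)) b - G1 i b‖ ^ 2)
    (fun i => 2 ^ P.d * ∑ b : PBond P i, ‖(pertVar (Averaging.iter (fun i => blockAvg (P := P) (j := i) (expMeanLogSU (n := Fin N))) i U₀) (Averaging.iter (fun i => blockAvg (P := P) (j := i) (expMeanLogSU (n := Fin N))) i W)) b - G1 i b‖ ^ 2) ?_).trans (le_of_eq ?_)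
  · intro i hi
    have hij : i < j := Finset.mem_range.mp hi
    calc ∑ z ∈ (univ.filter (fun w : Site P (j + 1) => ∀ κ, (w κ).val % P.L ^ (k - (j + 1)) = (P.L ^ (k - (j + 1)) - 1) / 2)), ∑ b ∈ (univ.filter (fun b : PBond P i => ∀ κ, ((b.src κ - (((z κ).val * P.L ^ (j + 1 - i) + (P.L ^ (j + 1 - i) - 1) / 2 : ℕ) : ZMod (P.sitesPerDir i))).valMinAbs).natAbs ≤ P.L ^ (j + 1 - i) - 2)), ‖(pertVar (Averaging.iter (fun i => blockAvg (P := P) (j := i) (expMeanLogSU (n := Fin N))) i U₀) (Averaging.iter (fun i => blockAvg (P := P) (j := i) (expMeanLogSU (n := Fin N))) i W)) b - G1 i b‖ ^ 2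
        ≤ ∑ z : Site P (j + 1), ∑ b ∈ (univ.filter (fun b : PBond P i => ∀ κ, ((b.src κ - (((z κ).val * P.L ^ (j + 1 - i) + (P.L ^ (j + 1 - i) - 1) / 2 : ℕ) : ZMod (P.sitesPerDir i))).valMinAbs).natAbs ≤ P.L ^ (j + 1 - i) - 2)), ‖(pertVar (Averaging.iter (fun i => blockAvg (P := P) (j := i) (expMeanLogSU (n := Fin N))) i U₀) (Averaging.iter (fun i => blockAvg (P := P) (j := i) (expMeanLogSU (n := Fin N))) i W)) b - G1 i b‖ ^ 2 :=
          Finset.sum_le_sum_of_subset_of_nonneg (Finset.subset_univ _) fun z _ _ => Finset.sum_nonneg fun b _ => sq_nonneg _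
      _ ≤ 2 ^ P.d * ∑ b : PBond P i, ‖(pertVar (Averaging.iter (fun i => blockAvg (P := P) (j := i) (expMeanLogSU (n := Fin N))) i U₀) (Averaging.iter (fun i => blockAvg (P := P) (j := i) (expMeanLogSU (n := Fin N))) i W)) b - G1 i b‖ ^ 2 :=
          sum_sum_family_le (P := P) (by omega) hij.le (fun b => ‖(pertVar (Averaging.iter (fun i => blockAvg (P := P) (j := i) (expMeanLogSU (n := Fin N))) i U₀) (Averaging.iter (fun i => blockAvg (P := P) (j := i) (expMeanLogSU (n := Fin N))) i W)) b - G1 i b‖ ^ 2) fun b => sq_nonneg _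
  · rfl

/-! ## §3 ★★ The level row modulo the displayed rows: §2 ∘ ✓`Prop7N32SymLevelRowReals.real_assembly` -/

/-- ★★ **THE LEVEL ROW MODULO DISPLAYED ROWS** (generic `P` with `2 ≤ L`, `ρ₁ ≤ L⁻²`, `ρ₂ ≤ L⁻¹`; `SU(N)`): §2 then the pure-real ✓`real_assembly` — the first-order
mass row ((n3)), the deviation row (N6d), the two localised level-0 rows (N4∕S) and the two exponential rows are HYPOTHESES here; conclusion `Σ_c‖Y_k c − Q k X c‖ ≤ A·(Lᵏ)⁻¹ + B·Lᵏ`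
with the displayed absolute `A`, `B`. [cite: Balaban1985Averaging, Prop. 3 (122)-(126) p.36, (97)-(100) p.32; Balaban1984PropagatorsI, (1.18)-(1.20) pp.19-20] -/
theorem sum_norm_levelRatio_sub_trueLinIter_le_of_rows (U₀ W : GaugeField P 0 (Matrix.specialUnitaryGroup (Fin N) ℂ)) {k : ℕ} (hk : k ≤ P.m + P.K)
    (Q : (k : ℕ) → (PBond P 0 → Matrix (Fin N) (Fin N) ℂ) → PBond P k → Matrix (Fin N) (Fin N) ℂ) (hQ0 : ∀ Y, Q 0 Y = Y)
    (hQs : ∀ (k : ℕ) (Y : PBond P 0 → Matrix (Fin N) (Fin N) ℂ) (c : PBond P (k + 1)), Q (k + 1) Y c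
      = (fderiv ℂ (eml : (Idx P → Matrix (Fin N) (Fin N) ℂ) → Matrix (Fin N) (Fin N) ℂ)
            (fun i => ((loopHol (Averaging.iter (fun i => blockAvg (P := P) (j := i) (expMeanLogSU (n := Fin N))) k U₀) c i : Matrix.specialUnitaryGroup (Fin N) ℂ) : Matrix (Fin N) (Fin N) ℂ))
            (fun i => covWalkSum (Averaging.iter (fun i => blockAvg (P := P) (j := i) (expMeanLogSU (n := Fin N))) k U₀) (Q k Y) (walk (emb c.src) (loopWord P.L c.dir (off i.1) i.2.1 i.2.2))
              * ((loopHol (Averaging.iter (fun i => blockAvg (P := P) (j := i) (expMeanLogSU (n := Fin N))) k U₀) c i : Matrix.specialUnitaryGroup (Fin N) ℂ) : Matrix (Fin N) (Fin N) ℂ))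
            * star ((corr (expMeanLogSU (n := Fin N)) (Averaging.iter (fun i => blockAvg (P := P) (j := i) (expMeanLogSU (n := Fin N))) k U₀) c : Matrix.specialUnitaryGroup (Fin N) ℂ) : Matrix (Fin N) (Fin N) ℂ)
          + ((corr (expMeanLogSU (n := Fin N)) (Averaging.iter (fun i => blockAvg (P := P) (j := i) (expMeanLogSU (n := Fin N))) k U₀) c : Matrix.specialUnitaryGroup (Fin N) ℂ) : Matrix (Fin N) (Fin N) ℂ)
            * covWalkSum (Averaging.iter (fun i => blockAvg (P := P) (j := i) (expMeanLogSU (n := Fin N))) k U₀) (Q k Y) (walk (emb c.src) (List.replicate P.L (c.dir, true)))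
            * star ((corr (expMeanLogSU (n := Fin N)) (Averaging.iter (fun i => blockAvg (P := P) (j := i) (expMeanLogSU (n := Fin N))) k U₀) c : Matrix.specialUnitaryGroup (Fin N) ℂ) : Matrix (Fin N) (Fin N) ℂ)))
    (G1 : (k : ℕ) → PBond P k → Matrix (Fin N) (Fin N) ℂ) (hG10 : ∀ b, G1 0 b = pertVar U₀ W b)
    (hG1s : ∀ (k : ℕ) (c : PBond P (k + 1)), G1 (k + 1) c
      = (fderiv ℂ (eml : (Idx P → Matrix (Fin N) (Fin N) ℂ) → Matrix (Fin N) (Fin N) ℂ)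
            (fun i => ((loopHol (Averaging.iter (fun i => blockAvg (P := P) (j := i) (expMeanLogSU (n := Fin N))) k U₀) c i : Matrix.specialUnitaryGroup (Fin N) ℂ) : Matrix (Fin N) (Fin N) ℂ))
            (fun i => covWalkSum (Averaging.iter (fun i => blockAvg (P := P) (j := i) (expMeanLogSU (n := Fin N))) k U₀) (G1 k) (walk (emb c.src) (loopWord P.L c.dir (off i.1) i.2.1 i.2.2))
              * ((loopHol (Averaging.iter (fun i => blockAvg (P := P) (j := i) (expMeanLogSU (n := Fin N))) k U₀) c i : Matrix.specialUnitaryGroup (Fin N) ℂ) : Matrix (Fin N) (Fin N) ℂ))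
            * star ((corr (expMeanLogSU (n := Fin N)) (Averaging.iter (fun i => blockAvg (P := P) (j := i) (expMeanLogSU (n := Fin N))) k U₀) c : Matrix.specialUnitaryGroup (Fin N) ℂ) : Matrix (Fin N) (Fin N) ℂ)
          + ((corr (expMeanLogSU (n := Fin N)) (Averaging.iter (fun i => blockAvg (P := P) (j := i) (expMeanLogSU (n := Fin N))) k U₀) c : Matrix.specialUnitaryGroup (Fin N) ℂ) : Matrix (Fin N) (Fin N) ℂ)
            * covWalkSum (Averaging.iter (fun i => blockAvg (P := P) (j := i) (expMeanLogSU (n := Fin N))) k U₀) (G1 k) (walk (emb c.src) (List.replicate P.L (c.dir, true)))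
            * star ((corr (expMeanLogSU (n := Fin N)) (Averaging.iter (fun i => blockAvg (P := P) (j := i) (expMeanLogSU (n := Fin N))) k U₀) c : Matrix.specialUnitaryGroup (Fin N) ℂ) : Matrix (Fin N) (Fin N) ℂ))
        - ((((Fintype.card (Idx P) : ℂ))⁻¹ • ∑ i : Idx P,
              covWalkSum (Averaging.iter (fun i => blockAvg (P := P) (j := i) (expMeanLogSU (n := Fin N))) k U₀) (G1 k) (walk (emb c.src) (stairWord i.2.1 (off i.1))))
            - (((Averaging.iter (fun i => blockAvg (P := P) (j := i) (expMeanLogSU (n := Fin N))) (k + 1) U₀) c : Matrix.specialUnitaryGroup (Fin N) ℂ) : Matrix (Fin N) (Fin N) ℂ)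
              * (((Fintype.card (Idx P) : ℂ))⁻¹ • ∑ i : Idx P,
              covWalkSum (Averaging.iter (fun i => blockAvg (P := P) (j := i) (expMeanLogSU (n := Fin N))) k U₀) (G1 k) (walk (emb c.tgt) (stairWord i.2.1 (off i.1))))
              * star (((Averaging.iter (fun i => blockAvg (P := P) (j := i) (expMeanLogSU (n := Fin N))) (k + 1) U₀) c : Matrix.specialUnitaryGroup (Fin N) ℂ) : Matrix (Fin N) (Fin N) ℂ)))
    (X : PBond P 0 → Matrix (Fin N) (Fin N) ℂ)
    (a : ℕ → ℝ) (ha0 : ∀ j, 0 ≤ a j)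
    (hα : ∀ j < k, ∀ (c : PBond P (j + 1)) (i : Idx P), dist1 (loopHol (Averaging.iter (fun i => blockAvg (P := P) (j := i) (expMeanLogSU (n := Fin N))) j U₀) c i) ≤ a j)
    (ha24 : ∀ j < k, a j ≤ 1 / 24) (haN : ∀ j < k, a j < deltaSU (Fin N))
    (s : ℕ → ℝ) (hs0 : ∀ j < k, 0 ≤ s j)
    (hs : ∀ j < k, ∀ b : PBond P j, ‖(pertVar (Averaging.iter (fun i => blockAvg (P := P) (j := i) (expMeanLogSU (n := Fin N))) j U₀) (Averaging.iter (fun i => blockAvg (P := P) (j := i) (expMeanLogSU (n := Fin N))) j W)) b‖ ≤ s j)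
    (h72 : ∀ j < k, 72 * ((((P.d + 2) * P.L : ℕ) : ℝ) * ((2 * P.d * (P.L : ℝ) ^ P.d) * s j)) ≤ 1)
    (hsN : ∀ j < k, 3 * ((((P.d + 2) * P.L : ℕ) : ℝ) * ((2 * P.d * (P.L : ℝ) ^ P.d) * s j)) + a j < deltaSU (Fin N))
    (hL2 : (2 : ℝ) ≤ (P.L : ℝ)) (hρ₁ : (((P.L : ℝ) ^ P.d)⁻¹ * (P.L : ℝ)) ≤ ((P.L : ℝ) ^ 2)⁻¹) (hρ₂ : (((P.L : ℝ) ^ P.d)⁻¹ * (P.L : ℝ) ^ 2) ≤ (P.L : ℝ)⁻¹)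
    (hE : ∀ j ≤ k, Real.exp ((159 * (((P.d + 2) * P.L : ℕ) : ℝ) * (2 * P.d)) / (((P.L : ℝ) ^ P.d)⁻¹ * (P.L : ℝ)) * ∑ i ∈ Finset.range j, a i) ≤ 3 / 2)
    (hE' : ∀ i < k, Real.exp (2 * ((159 * (((P.d + 2) * P.L : ℕ) : ℝ) * Real.sqrt (2 * P.d * (P.L : ℝ) ^ P.d * (2 * P.d))) / Real.sqrt (((P.L : ℝ) ^ P.d)⁻¹ * (P.L : ℝ) ^ 2) * ∑ j ∈ Finset.range i, a j)) ≤ 9 / 4)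
    {AM BM BD M₀' GAP₀ M₁ GAP₁ cG : ℝ} (hAM : 0 ≤ AM) (hBM : 0 ≤ BM) (hBD : 0 ≤ BD) (hM₀' : 0 ≤ M₀') (hGAP₀ : 0 ≤ GAP₀) (hM₁ : 0 ≤ M₁) (hGAP₁ : 0 ≤ GAP₁) (hcG : 0 ≤ cG)
    (hM : ∀ i < k, ∑ b : PBond P i, ‖(pertVar (Averaging.iter (fun i => blockAvg (P := P) (j := i) (expMeanLogSU (n := Fin N))) i U₀) (Averaging.iter (fun i => blockAvg (P := P) (j := i) (expMeanLogSU (n := Fin N))) i W)) b‖ ^ 2 ≤ AM * ((P.L : ℝ) ^ i)⁻¹ + BM * (P.L : ℝ) ^ i)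
    (hDev : ∀ i < k, ∑ b : PBond P i, ‖(pertVar (Averaging.iter (fun i => blockAvg (P := P) (j := i) (expMeanLogSU (n := Fin N))) i U₀) (Averaging.iter (fun i => blockAvg (P := P) (j := i) (expMeanLogSU (n := Fin N))) i W)) b - G1 i b‖ ^ 2 ≤ BD * (P.L : ℝ) ^ i)
    (hLoc0 : ∀ j < k, ∑ z ∈ (univ.filter (fun w : Site P (j + 1) => ∀ κ, (w κ).val % P.L ^ (k - (j + 1)) = (P.L ^ (k - (j + 1)) - 1) / 2)), ∑ b ∈ (univ.filter (fun b : PBond P 0 => ∀ κ, ((b.src κ - (((z κ).val * P.L ^ (j + 1 - 0) + (P.L ^ (j + 1 - 0) - 1) / 2 : ℕ) : ZMod (P.sitesPerDir 0))).valMinAbs).natAbs ≤ P.L ^ (j + 1 - 0) - 2)), ‖pertVar U₀ W b‖ ^ 2 ≤ 2 * ((P.L : ℝ) ^ (j + 2) / (P.L : ℝ) ^ k) ^ 3 * M₀' + cG * (P.L : ℝ) ^ (2 * (j + 1)) * GAP₀)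
    (hLoc1 : ∀ j < k, ∑ z ∈ (univ.filter (fun w : Site P (j + 1) => ∀ κ, (w κ).val % P.L ^ (k - (j + 1)) = (P.L ^ (k - (j + 1)) - 1) / 2)), ∑ b ∈ (univ.filter (fun b : PBond P 0 => ∀ κ, ((b.src κ - (((z κ).val * P.L ^ (j + 1 - 0) + (P.L ^ (j + 1 - 0) - 1) / 2 : ℕ) : ZMod (P.sitesPerDir 0))).valMinAbs).natAbs ≤ P.L ^ (j + 1 - 0) - 2)), ‖pertVar U₀ W b - X b‖ ≤ 2 * ((P.L : ℝ) ^ (j + 2) / (P.L : ℝ) ^ k) ^ 3 * M₁ + cG * (P.L : ℝ) ^ (2 * (j + 1)) * GAP₁) :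
    ∑ c : PBond P k, ‖(pertVar (Averaging.iter (fun i => blockAvg (P := P) (j := i) (expMeanLogSU (n := Fin N))) k U₀) (Averaging.iter (fun i => blockAvg (P := P) (j := i) (expMeanLogSU (n := Fin N))) k W)) c - Q k X c‖
      ≤ (3 / 2 * (∑ b : PBond P 0, ‖pertVar U₀ W b - X b‖) + 3 / 2 * ((260 * ((((P.d + 2) * P.L : ℕ) : ℝ)) ^ 2 * (2 * P.d * (P.L : ℝ) ^ P.d) * (2 * P.d)) * AM) * (((P.L : ℝ) - 1)⁻¹ * (P.L : ℝ) ^ 2) + 2 * P.d * ((((P.d + 2) * P.L : ℕ) : ℝ) * (3 / 2)) * (2 * M₁ * ((P.L : ℝ) ^ 6 / ((P.L : ℝ) - 1)))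
            + 2 * P.d * ((((P.d + 2) * P.L : ℕ) : ℝ) * (3 / 2)) * ((260 * ((((P.d + 2) * P.L : ℕ) : ℝ)) ^ 2 * (2 * P.d * (P.L : ℝ) ^ P.d) * (2 * P.d)) * (9 / 2) * (2 * M₀') * ((P.L : ℝ) ^ 8 / (((P.L : ℝ) ^ 2 - 1) * ((P.L : ℝ) - 1))))) * ((P.L : ℝ) ^ k)⁻¹
        + (3 / 2 * ((260 * ((((P.d + 2) * P.L : ℕ) : ℝ)) ^ 2 * (2 * P.d * (P.L : ℝ) ^ P.d) * (2 * P.d)) * BM) * (1 - (P.L : ℝ)⁻¹ ^ 3)⁻¹ + 2 * P.d * ((((P.d + 2) * P.L : ℕ) : ℝ) * (3 / 2)) * (cG * GAP₁ * (P.L : ℝ) ^ 2)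
            + 2 * P.d * ((((P.d + 2) * P.L : ℕ) : ℝ) * (3 / 2)) * ((260 * ((((P.d + 2) * P.L : ℕ) : ℝ)) ^ 2 * (2 * P.d * (P.L : ℝ) ^ P.d) * (2 * P.d)) * (9 / 2) * (cG * GAP₀) * ((P.L : ℝ) ^ 4 * (((P.L : ℝ) - 1) ^ 2)⁻¹))
            + 2 * P.d * ((((P.d + 2) * P.L : ℕ) : ℝ) * (3 / 2)) * ((260 * ((((P.d + 2) * P.L : ℕ) : ℝ)) ^ 2 * (2 * P.d * (P.L : ℝ) ^ P.d) * (2 * P.d)) * (2 * 2 ^ P.d) * BD * ((1 - (P.L : ℝ)⁻¹ ^ 3)⁻¹ * ((P.L : ℝ) - 1)⁻¹))) * (P.L : ℝ) ^ k := by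
  have hLpos : (0 : ℝ) < (P.L : ℝ) := by exact_mod_cast P.L_pos
  have hρ0 : (0 : ℝ) ≤ (((P.L : ℝ) ^ P.d)⁻¹ * (P.L : ℝ)) := by positivity
  have hρ20 : (0 : ℝ) ≤ (((P.L : ℝ) ^ P.d)⁻¹ * (P.L : ℝ) ^ 2) := by positivity
  have hcE0 : (0 : ℝ) ≤ (260 * ((((P.d + 2) * P.L : ℕ) : ℝ)) ^ 2 * (2 * P.d * (P.L : ℝ) ^ P.d) * (2 * P.d)) := by positivity
  have h6b := sum_norm_levelRatio_sub_trueLinIter_le_localised U₀ W hk Q hQ0 hQs G1 hG10 hG1s X a ha0 hα ha24 haN s hs0 hs h72 hsN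
  have hR := real_assembly k hL2 hρ0 hρ₁ hρ20 hρ₂ hcE0 (show (0:ℝ) ≤ 2 * P.d by positivity) (Nat.cast_nonneg _ : (0:ℝ) ≤ (((P.d + 2) * P.L : ℕ) : ℝ))
    (show (0:ℝ) ≤ 2 ^ P.d by positivity) hcG (Finset.sum_nonneg fun _ _ => norm_nonneg _ : (0:ℝ) ≤ ∑ b : PBond P 0, ‖pertVar U₀ W b - X b‖)
    hAM hBM hBD hM₀' hGAP₀ hM₁ hGAP₁
    (fun j => Real.exp ((159 * (((P.d + 2) * P.L : ℕ) : ℝ) * (2 * P.d)) / (((P.L : ℝ) ^ P.d)⁻¹ * (P.L : ℝ)) * ∑ i ∈ Finset.range j, a i))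
    (fun i => Real.exp (2 * ((159 * (((P.d + 2) * P.L : ℕ) : ℝ) * Real.sqrt (2 * P.d * (P.L : ℝ) ^ P.d * (2 * P.d))) / Real.sqrt (((P.L : ℝ) ^ P.d)⁻¹ * (P.L : ℝ) ^ 2) * ∑ j ∈ Finset.range i, a j)))
    (fun i => ∑ b : PBond P i, ‖(pertVar (Averaging.iter (fun i => blockAvg (P := P) (j := i) (expMeanLogSU (n := Fin N))) i U₀) (Averaging.iter (fun i => blockAvg (P := P) (j := i) (expMeanLogSU (n := Fin N))) i W)) b‖ ^ 2)
    (fun i => ∑ b : PBond P i, ‖(pertVar (Averaging.iter (fun i => blockAvg (P := P) (j := i) (expMeanLogSU (n := Fin N))) i U₀) (Averaging.iter (fun i => blockAvg (P := P) (j := i) (expMeanLogSU (n := Fin N))) i W)) b - G1 i b‖ ^ 2)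
    (fun j => ∑ z ∈ (univ.filter (fun w : Site P (j + 1) => ∀ κ, (w κ).val % P.L ^ (k - (j + 1)) = (P.L ^ (k - (j + 1)) - 1) / 2)), ∑ b ∈ (univ.filter (fun b : PBond P 0 => ∀ κ, ((b.src κ - (((z κ).val * P.L ^ (j + 1 - 0) + (P.L ^ (j + 1 - 0) - 1) / 2 : ℕ) : ZMod (P.sitesPerDir 0))).valMinAbs).natAbs ≤ P.L ^ (j + 1 - 0) - 2)), ‖pertVar U₀ W b‖ ^ 2)
    (fun j => ∑ z ∈ (univ.filter (fun w : Site P (j + 1) => ∀ κ, (w κ).val % P.L ^ (k - (j + 1)) = (P.L ^ (k - (j + 1)) - 1) / 2)), ∑ b ∈ (univ.filter (fun b : PBond P 0 => ∀ κ, ((b.src κ - (((z κ).val * P.L ^ (j + 1 - 0) + (P.L ^ (j + 1 - 0) - 1) / 2 : ℕ) : ZMod (P.sitesPerDir 0))).valMinAbs).natAbs ≤ P.L ^ (j + 1 - 0) - 2)), ‖pertVar U₀ W b - X b‖)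
    hE (fun i => (Real.exp_pos _).le) hE'
    (fun i => Finset.sum_nonneg fun _ _ => sq_nonneg _) (fun i => Finset.sum_nonneg fun _ _ => sq_nonneg _)
    (fun j => Finset.sum_nonneg fun _ _ => Finset.sum_nonneg fun _ _ => sq_nonneg _)
    (fun j => Finset.sum_nonneg fun _ _ => Finset.sum_nonneg fun _ _ => norm_nonneg _)
    hM hDev hLoc0 hLoc1
  beta_reduce at hR
  exact h6b.trans hR


end Summit.QuantumFields.YangMills.Theorems.Prop7N32SymLocalisedRow

end
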